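import Literature.MathematicalPhysics.QuantumFieldTheory.Balaban1983to89.B15Prop1Thm1RowsOfExistsUniqueAtLengthB
import Literature.MathematicalPhysics.QuantumFieldTheory.Balaban1983to89.B11Thm1ExistsUniqueRealisedDataQsstar

/-!
# `Balaban1983to89.B15Prop1Thm1RowsOfExistsUniqueAtLengthBR` — [Balaban1985Variational] = «[15]», Thm 1 p. 279, (1)–(7) pp. 277–278, (11)–(14) pp. 279–280; [Balaban1988Convergent] = «[III]»,
# (2.1) p. 254, (2.12)–(2.13) pp. 256–257, (2.16), (2.18) p. 257; [Balaban1984PropagatorsII] = «[II]», (2.3) p. 224; [Balaban1989LargeFieldI] = «[IV]», (1.74) p. 192, Prop. 1 p. 194: THE AT-LENGTH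
# ROWS (E) AND (T1@q₀) OF THE (J0′) PRODUCER OVER A BOND-DATUM FAMILY WITH THE (E∕U) LETTER READ AT **REGULAR-REALISED DATA** (`B11Thm1ExistsUniqueRealisedDataB.DataRegularRealisedTop`)
# — the edition of `…AtLengthB` (✓, this lane g34) whose (E∕U) letter is DISCHARGEABLE from the ONE-LENGTH STEP token (`Summit.…N12Thm1EUNameBOfStepAtRealisedDataLam`, this lane g38)

Honest framing: statement-level skeleton of published theorems with citation tags; proofs where landed; nothing here is a claim about the Yang–Mills mass gap.  Cell `pub-ymgap`
(HUMAN RULINGS D-0062 ∕ D-0149), seat `pub-ymgap-dag-n12-c` g38 (R134 seat (a), N12 = [B15], s1, lane owner); count-neutral helper of K1⁹ `stmt-QuantumFields-27364`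
(`--kind proof --supports`); N12 NOT discharged; one finite 𝕋⁴ programme at fixed ε; nothing continuum ∕ ℝ⁴ ∕ OS ∕ mass-gap ∕ Clay.  THEOREMS ONLY (0 `def`, 0 `instance`, 0 `sorry`).

WHY.  N12's junction at print's datum (dag-n12-d g33 165∕166∕168) displays the two [15]-Theorem-1 names `h15`∕`h15EU` over `(lamDatum F, dataSmall7PTopOf F 2)` and feeds them, through
113's name-to-letter conversion, into `…AtLengthB` — whose letters carry the record's (7) row `Sect2.DataSmall7PTop`.  This lane's g38 files show that at REGULAR-REALISED data
(`dataRegularRealisedTopOf F 2`: realised below the top + full per-level plaquette smallness + the fine member small on `plaqsOf Ω₁`) the (R)ᴮ name is inhabited and the (E∕U)ᴮ name follows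
from the ONE-LENGTH STEP token ALONE (`thm1EUNameB_grid_lamDatum_realised_of_step`), and that the junction's own datum `M˙(Q_k^{s*}Ṽ_k)` IS regular-realised along `Z`'s maximal sequence
(`B11Thm1ExistsUniqueRealisedDataQsstar`).  THIS FILE is the missing Literature link of the re-key: `…AtLengthB`'s theorem with the (E∕U) letter `h15EUT`'s data row reading
`B11Thm1ExistsUniqueRealisedDataB.DataRegularRealisedTop (Node00.avOfRecord F 2 Kt) s.Ω (Node00.suppDomOfRecord F ν Kt s.Ω) (k i) δ W` (the (8)-letter `h15T` keeps `Sect2.DataSmall7PTop`, at which it is INHABITED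
by K0⁷'s stub 1) — binders, rows and conclusion otherwise BYTE-IDENTICAL — so that a junction edition displaying `h15EU` at `(lamDatum F, dataRegularRealisedTopOf F 2)` (and `h15` as before)
consumes it by name and `h15EU` is then discharged from STEPᴮ.

HONESTY GUARD (director-ym №338 (5)).  PURELY ADDITIVE: `…AtLengthB` (record's (7)) and `…AtLength` ∕ `_pos` editions stay landed and true on their own text; this edition changes ONLY the data
row the (E∕U) letter reads (a STRONGER data hypothesis inside the letter = a WEAKER letter = a stronger theorem for the consumer who holds only the realised-data name); the datum row is
derived a second time for the (1.74) datum by `dataRegularRealisedTop_avgFamily_qsstarGIter0` (ranges `plaqsOf (support) ∕ plaqsOf (Ω₁(Z)) ∕ plaqsOf (pts n (Ω_n(Z)))` inside `Z` by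
`plaqsOf_hullD_maxDomT_one_subset_plaqsInside` ∕ `plaqsOf_maxDomT_one_subset_plaqsInside` ∕ `plaqsOf_pts_maxDomT_subset_plaqsInside`, read back at `s.Ω`).  Proof otherwise VERBATIM.

CONTENTS.  §1 `eta_pos` (private); §2 ★★★ `thm1Rows_atZ_of_thm1TorusClass_existsUnique_atLengthBR` (the order bookkeeping `thm1RowB_of_existsUnique` etc. BY NAME from `…AtLengthB` §0).

HONEST SCOPE.  Bookkeeping by name over landed modules; [15] Theorem 1 ((8) at the record's (7); existence ∕ uniqueness at regular-realised data; the instance's length `k i ≥ 1`, over a bond datum) stays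
DISPLAYED — at `bd := lamDatumP` and K0⁷'s grid guard the (8)-letter is inhabited (K0⁷ stub 1) and the (E∕U)-letter is the body of the name `…N12Thm1EUNameBOfStepAtRealisedDataLam` serves from STEPᴮ;
nothing of Bałaban's asserted; count-neutral; N12 NOT discharged; K0⁷ ∕ K1⁹ NOT closed; counts unmoved; R4 closes only the conditional finite-𝕋⁴ rung `BalabanLadder.UV` — no summit statement
is proved here and NOT the Yang–Mills mass gap (Clay); nothing continuum ∕ ℝ⁴ ∕ OS.
-/

noncomputable section

open Set

namespace Literature.MathematicalPhysics.QuantumFieldTheory.Balaban1983to89.B15Prop1Thm1RowsOfExistsUniqueAtLengthBR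

open T4Continuum B15DeterminingSets GaugeField B15Prop1Carrier B8Eq17ClassAkV1 BlockAveraging
open B14.Eq22Determines (blockIter IsBlockUnion)
open Literature.MathematicalPhysics.QuantumFieldTheory.BalabanImbrieJaffe1984to88.BIJ85Eq453GaugeField (qsstarGIter0)
open B15Prop1DatumSmall7AtZSequence B15Prop1Thm1GeneralFormAtZSequence B15Prop1Thm1GeneralFormShapes
open B16Sect1Backgrounds (toMS)
open B15Prop1Thm1RowsOfExistsUnique B15Prop1Thm1RowsOfExistsUniqueAtLengthB
open B15DeterminingSetsB (BDetSet IsMinimizerB AgreeOnB)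
open B11Thm1ExistsUniqueRealisedDataB (DataRegularRealisedTop dataRegularRealisedTop_avgFamily_qsstarGIter0 plaqsOf_hullD_maxDomT_one_subset_plaqsInside plaqsOf_maxDomT_one_subset_plaqsInside)

/-! ## §1  `η_j > 0` -/

section Eta

variable {F : T4Family}


/-- `0 < η_j` (`η_j = L^{−j}`, `L ≥ 1`). [folklore] -/
private theorem eta_pos (K j : ℕ) : 0 < (F.P K).eta j := by
  have hL : (0 : ℝ) < (F.P K).L := by exact_mod_cast (F.P K).L_pos
  unfold Params.eta
  positivity

end Eta

/-! ## §2  At print's (1.74) object: the rows (E) and (T1@q₀) for EVERY base field of the strict guard, from the two [15] letters READ AT THE INSTANCES' OWN LENGTHS `k i` (the lane's `_pos` §2, verbatim but for the two letter binders and their two calls) -/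

section AtZ

open Classical
open Metric
open B14DomainGeom (IsUnionOfCubes)
open B15Eq112TorusCover (cover)
open B14.Eq213MaximalDomains (side)
open B14.Eq213DetSet B15Sect1Instances B16Sect1Wilson B16Sect1Backgrounds
open T4CubeChartGnomonic (SU2)
open T4AxialGaugeSmallField (castSite boxPlaqs)
open B15Extension193 (extend)
open B15ShellGauge193 (shellGauge)
open B15ShellGauge193Local (dist1_plaqHol_extend_shellGauge_le)

/-- ★★★ **REGULAR-REALISED-DATA EDITION OF THE (E∕U) LETTER (the existence ∕ uniqueness letter `h15EUT` reads `B11Thm1ExistsUniqueRealisedDataB.DataRegularRealisedTop …` as its data row — the predicate at which the SUPPLY-at-1 ∕ LIFT tokens are PROVED and the (E∕U)ᴮ name follows from the ONE-LENGTH STEP token alone, `Summit.…N12Thm1EUNameBOfStepAtRealisedDataLam`; the (8)-letter `h15T` keeps the record's (7) row `Sect2.DataSmall7PTop`, where it is INHABITED; the (1.74) datum `M˙(Q_k^{s*}Ṽ_k)` satisfies BOTH rows along `Z`'s maximal sequence; everything else as in the bond-datum edition `…_atLengthB`). BOND-DATUM EDITION (the letters and the rows read the determining datum `bd (k i) ·`;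 everything else as in dag-n12-d's at-length edition). THE ROWS (E) AND (T1@q₀) OF «(J0′) OF RECORD» FOR EVERY BASE FIELD OF THE STRICT GUARD, FROM THE TWO [15] LETTERS READ AT EACH INSTANCE's OWN LENGTH — AT-LENGTH EDITION** of the lane's
`B15Prop1Thm1RowsOfExistsUniquePos.thm1Rows_atZ_of_thm1TorusClass_existsUnique_pos`: K0⁷'s (8)-letter `h15T` ([15] Thm 1 (R) over NODE 00's torus class of `LʲM₁`-cube unions at `(ν, Kt)`) and the
EXISTENCE ∕ UNIQUENESS letter `h15EUT` (conclusion «∃ minimiser over class (6) at `ε₀`» ∧ «any two minimisers differ by a gauge with equal, central scale-`j` images at the two ends of every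
constrained bond»), EACH STATED PER INSTANCE `i` AT THE LENGTH `k i` ONLY (`∀ i, ∀ s : Seq … (k i), …`; the `_pos` bodies with `k'` read as `k i`; the rows `k i ≤ m + K`, `0 < k i`,
`L^{k i}M₁ ∣ sitesPerDir 0` are the displayed instance rows `hk` ∕ `hk0` ∕ `hdiv`) — so that a producer guarded in the length (the K0 road's grid-guarded (8)-token
`Node00.VariationalThm1RegSepCoP7MG F 2 A‴ B₃ a₀ a₁`) serves exactly the instances passing its guard.  Per instance `i` of the knit (`Z, Λ, k, lo, hi, ext`: the geometry rows of
`nearValue_letter_of_thm1Guarded` VERBATIM), for every `0 < ε` with `(c_E+1)ε ≤ a₁`, every class tolerance `εr ≥ B₃(c_E+1)ε`, every `ε₀` with `εr < ε₀ ≤ a₀`, and every base field `V_k` with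
`PlaqSmallOn (plaqsInside (pts k (Z ∩ Λᶜ))) ε V_k`:
(E) `∃ U₀, IsMinimizer (M˙) (U_k({Ω_j(Z)}, εr)) (𝐁_k(Z)) (M˙(Q_k^{s*}(ext V_k))) U₀` — U2 :171–173 VERBATIM at `ν⟨εreg := εr⟩` — and, for EVERY such minimiser `U₀`,
(T1@q₀) over `reg' := closure (U_k({Ω_j(Z)}, εr))` — dag-n12-d (A″) :196–200 VERBATIM.
Proof: the lane's `_pos` proof verbatim but for the two letter calls. [cite: Balaban1985Variational, (1) p.277, (2),(3),(5),(6),(7) p.278, Thm 1 (8) p.279; Balaban1988Convergent, (2.1) p.254, p.255, (2.12)–(2.13) pp.256–257, (2.18) p.257; Balaban1989LargeFieldI, (1.74) p.192, p.193 ll.14–20, Prop. 1 p.194; Balaban1989LargeFieldII, (1.12)–(1.13) p.359; Balaban1985RegularSpaces, (1.3)–(1.9) p.77] -/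
theorem thm1Rows_atZ_of_thm1TorusClass_existsUnique_atLengthBR {F : T4Family} (ν : Node00.Stage7Numerics) (Kt : ℕ) (hd3 : 3 ≤ (F.P Kt).d) {ι : Type}
    (Z Λ : ι → Set (Site (F.P Kt) 0)) (k : ι → ℕ) (hk0 : ∀ i, 0 < k i) (hk : ∀ i, k i ≤ (F.P Kt).m + (F.P Kt).K)
    (lo hi : ι → Fin (F.P Kt).d → ℤ) (n : ι → ℕ) (hn : ∀ i κ, hi i κ ≤ lo i κ + n i)
    (hbox : ∀ i, pts (k i) (Λ i) = (castSite '' Set.Icc (lo i) (hi i) : Set (Site (F.P Kt) (k i))))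
    (hZ : ∀ i, (boxPlaqs (lo i - 1) (hi i + 1) : Set (Plaq (F.P Kt) (k i))) ⊆ plaqsInside (pts (k i) (Z i)))
    (hN5 : ∀ i κ, ((hi i κ - lo i κ + 1).toNat : ℤ) + 5 < (F.P Kt).sitesPerDir (k i))
    (ext : ∀ i, GaugeField (F.P Kt) (k i) SU2 → GaugeField (F.P Kt) (k i) SU2)
    (hext : ∀ i Vk, ext i Vk = extend (pts (k i) (Λ i)) (shellGauge Vk (lo i) (hi i)) Vk)
    (hlohi : ∀ i, lo i ≤ hi i)
    -- (Gᵃ) geometry of `Z`: a union of `k`-blocks; print's `M₁ ≥ 2` and the torus divisibility of the `LʲM₁`-cube partitions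
    (hZblk : ∀ i, IsBlockUnion (k i) (Z i))
    (hM2 : 2 ≤ ν.M₁) (hdiv : ∀ i, side (F.P Kt).L ν.M₁ (k i) ∣ (F.P Kt).sitesPerDir 0)
    -- the BOND-DATUM FAMILY (reading (b): `B15Sect1Instances.genSetDatumP`; print's [II] (2.3): `lamDatumP`), reading the levels `1…k` of its sequence only
    (bd : ℕ → (ℕ → Set (Site (F.P Kt) 0)) → BDetSet (F.P Kt)) (hbdΩ : ∀ (i : ι) (Ω Ω' : ℕ → Set (Site (F.P Kt) 0)), (∀ j, 1 ≤ j → j ≤ k i → Ω j = Ω' j) → bd (k i) Ω = bd (k i) Ω')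
    -- bookkeeping constants
    {cE B₃ a₀ a₁ : ℝ} (hcE0 : 0 ≤ cE) (hcE : ∀ i, 12 * ((F.P Kt).d : ℝ) * ((n i : ℝ) + 2) ^ 2 ≤ cE)
    -- [15] THEOREM 1 (R) = (8) OVER NODE 00's TORUS CLASS (shape (C)), READ AT EACH INSTANCE's OWN LENGTH `k i` (served by the K0 road's grid-guarded (8)-token
    -- `Node00.VariationalThm1RegSepCoP7MG F 2 A‴ B₃ a₀ a₁` at instances passing the guard — dag-n12-d `BalabanUVNodesN12Thm1LettersAtLengthOfK0GridG`; by the `_pos` letter at every instance)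
    (h15T : ∀ (i : ι) (s : B14.Eq218Concrete.Seq (fun n : ℕ => Node00.unionsOfCubes (F.P Kt) (side (F.P Kt).L ν.M₁ n)) (k i)),
      Node00.Sect2.SeqSeparated ν.M₁ s → 0 < ν.M₁ →
      ∀ (ε₀ : ℝ) (δ : ℕ → ℝ), (∀ j, j ≤ k i → 0 < δ j ∧ δ j ≤ a₁ ∧ B₃ * δ j ≤ ε₀) → (∀ j, j < k i → δ j ≤ 2 * δ (j + 1)) →
      (∀ j, j < k i → δ (j + 1) ≤ 2 * δ j) → ε₀ ≤ a₀ →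
      ∀ W : MSField (F.P Kt) SU2,
        Node00.Sect2.DataSmall7PTop (Node00.avOfRecord F 2 Kt) s.Ω (Node00.suppDomOfRecord F ν Kt s.Ω) (k i) δ W →
        ∀ U₀ : GaugeField (F.P Kt) 0 SU2, IsMinimizerB (Node00.avOfRecord F 2 Kt)
            {U | (∀ j, j ≤ k i → PlaqSmallOn (Node00.Sect2.omegaPlaqsTop s.Ω (Node00.suppDomOfRecord F ν Kt s.Ω) j)
                (ε₀ * (F.P Kt).eta j ^ 2) U) ∧
              Node00.Sect2.CoDivClassOnTop s.Ω (Node00.suppDomOfRecord F ν Kt s.Ω) (k i) ε₀ U}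
            (bd (k i) s.Ω) W U₀ →
          (∀ j, j ≤ k i → PlaqSmallOn (Node00.Sect2.omegaPlaqsTop s.Ω (Node00.suppDomOfRecord F ν Kt s.Ω) j)
              (B₃ * δ j * (F.P Kt).eta j ^ 2) U₀) ∧
            ∀ j, j ≤ k i → Node00.Sect2.CoDivSmallOn (Node00.Sect2.omegaBondsTop s.Ω (Node00.suppDomOfRecord F ν Kt s.Ω) j)
              (B₃ * δ j * (F.P Kt).eta j ^ 3) U₀)
    -- [15] THEOREM 1, EXISTENCE OF THE MINIMAL ORBIT ∕ UNIQUENESS MODULO TOWER-CENTRAL GAUGES OVER NODE 00's TORUS CLASS, READ AT EACH INSTANCE's OWN LENGTH `k i ≥ 1` (no producer in the tree)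
    (h15EUT : ∀ (i : ι) (s : B14.Eq218Concrete.Seq (fun n : ℕ => Node00.unionsOfCubes (F.P Kt) (side (F.P Kt).L ν.M₁ n)) (k i)),
      Node00.Sect2.SeqSeparated ν.M₁ s → 0 < ν.M₁ →
      ∀ (ε₀ : ℝ) (δ : ℕ → ℝ), (∀ j, j ≤ k i → 0 < δ j ∧ δ j ≤ a₁ ∧ B₃ * δ j ≤ ε₀) → (∀ j, j < k i → δ j ≤ 2 * δ (j + 1)) →
      (∀ j, j < k i → δ (j + 1) ≤ 2 * δ j) → ε₀ ≤ a₀ →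
      ∀ W : MSField (F.P Kt) SU2,
        B11Thm1ExistsUniqueRealisedDataB.DataRegularRealisedTop (Node00.avOfRecord F 2 Kt) s.Ω (Node00.suppDomOfRecord F ν Kt s.Ω) (k i) δ W →
        (∃ U₀ : GaugeField (F.P Kt) 0 SU2, IsMinimizerB (Node00.avOfRecord F 2 Kt)
            {U | (∀ j, j ≤ k i → PlaqSmallOn (Node00.Sect2.omegaPlaqsTop s.Ω (Node00.suppDomOfRecord F ν Kt s.Ω) j)
                (ε₀ * (F.P Kt).eta j ^ 2) U) ∧
              Node00.Sect2.CoDivClassOnTop s.Ω (Node00.suppDomOfRecord F ν Kt s.Ω) (k i) ε₀ U}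
            (bd (k i) s.Ω) W U₀) ∧
        ∀ U₁ U₂ : GaugeField (F.P Kt) 0 SU2,
          IsMinimizerB (Node00.avOfRecord F 2 Kt)
            {U | (∀ j, j ≤ k i → PlaqSmallOn (Node00.Sect2.omegaPlaqsTop s.Ω (Node00.suppDomOfRecord F ν Kt s.Ω) j)
                (ε₀ * (F.P Kt).eta j ^ 2) U) ∧
              Node00.Sect2.CoDivClassOnTop s.Ω (Node00.suppDomOfRecord F ν Kt s.Ω) (k i) ε₀ U}
            (bd (k i) s.Ω) W U₁ →
          IsMinimizerB (Node00.avOfRecord F 2 Kt)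
            {U | (∀ j, j ≤ k i → PlaqSmallOn (Node00.Sect2.omegaPlaqsTop s.Ω (Node00.suppDomOfRecord F ν Kt s.Ω) j)
                (ε₀ * (F.P Kt).eta j ^ 2) U) ∧
              Node00.Sect2.CoDivClassOnTop s.Ω (Node00.suppDomOfRecord F ν Kt s.Ω) (k i) ε₀ U}
            (bd (k i) s.Ω) W U₂ →
          ∃ u : GaugeTransf (F.P Kt) 0 SU2,
            (∀ j, j ≤ k i → ∀ b ∈ bd (k i) s.Ω j, toMS u j b.src = toMS u j b.tgt ∧ ∀ g : SU2, toMS u j b.src * g = g * toMS u j b.src) ∧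
              gaugeAct u U₁ = U₂) :
    ∀ i (εr ε₀ ε : ℝ) (Vk : GaugeField (F.P Kt) (k i) SU2), 0 < ε → (cE + 1) * ε ≤ a₁ → B₃ * ((cE + 1) * ε) ≤ εr → εr < ε₀ → ε₀ ≤ a₀ →
      PlaqSmallOn (plaqsInside (pts (k i) (Z i ∩ (Λ i)ᶜ))) ε Vk →
      (∃ U₀ : GaugeField (F.P Kt) 0 SU2,
          IsMinimizerB (Node00.avOfRecord F 2 Kt) (Node00.regMSCoPOfRecord F 2 {ν with εreg := εr} Kt (k i) (maxDomT ν.M₁ (Z i))) (bd (k i) (maxDomT ν.M₁ (Z i)))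
            (avgFamily (Node00.avOfRecord F 2 Kt) (qsstarGIter0 (k i) (ext i Vk))) U₀) ∧
      ∀ U₀ : GaugeField (F.P Kt) 0 SU2,
        IsMinimizerB (Node00.avOfRecord F 2 Kt) (Node00.regMSCoPOfRecord F 2 {ν with εreg := εr} Kt (k i) (maxDomT ν.M₁ (Z i))) (bd (k i) (maxDomT ν.M₁ (Z i)))
            (avgFamily (Node00.avOfRecord F 2 Kt) (qsstarGIter0 (k i) (ext i Vk))) U₀ →
        ∀ U ∈ closure (Node00.regMSCoPOfRecord F 2 {ν with εreg := εr} Kt (k i) (maxDomT ν.M₁ (Z i))),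
          AgreeOnB (bd (k i) (maxDomT ν.M₁ (Z i))) (avgFamily (Node00.avOfRecord F 2 Kt) U) (avgFamily (Node00.avOfRecord F 2 Kt) (qsstarGIter0 (k i) (ext i Vk))) →
          wilsonAction4 U ≤ wilsonAction4 U₀ →
            ∃ u : GaugeTransf (F.P Kt) 0 SU2,
              (∀ j, j ≤ k i → ∀ b ∈ bd (k i) (maxDomT ν.M₁ (Z i)) j, toMS u j b.src = toMS u j b.tgt ∧ ∀ g : SU2, toMS u j b.src * g = g * toMS u j b.src) ∧
                gaugeAct u U = U₀ := by
  intro i εr ε₀ ε Vk hε hεa₁ hεr hr₀ ha₀ hreg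
  have hd : 2 ≤ (F.P Kt).d := by omega
  have hM : 1 ≤ ν.M₁ := le_trans one_le_two hM2
  have hki : 1 ≤ k i := hk0 i
  -- `Z`'s maximal sequence as a separated (2.18) index, with print's cube letters, re-indexed over NODE 00's torus class
  obtain ⟨s, hsΩ, -, hscube, hsep⟩ := exists_seq_maxDomT hM (Z i) (hdiv i)
  obtain ⟨s', hΩ'⟩ := exists_seq_torusClass_of_cubeLetters hM s hscube
  have hsep' : Node00.Sect2.SeqSeparated ν.M₁ s' := (seqSeparated_iff_of_Ω_eq ν.M₁ hΩ').2 hsep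
  have hw1 : s.Ω 1 = maxDomT ν.M₁ (Z i) 1 := hsΩ 1 le_rfl hki
  -- (a) the p. 193 extension is `(cE+1)ε`-small on the `k`-plaquettes inside `Z`
  have hN3 : ∀ κ, hi i κ - lo i κ + 3 < ((F.P Kt).sitesPerDir (k i) : ℤ) := fun κ => by
    have h5 := hN5 i κ
    have hle : lo i κ ≤ hi i κ := hlohi i κ
    rw [Int.toNat_of_nonneg (by linarith)] at h5
    linarith
  have hδ₀ : 0 < (cE + 1) * ε := by positivity
  have hV : PlaqSmallOn (plaqsInside (pts (k i) (Z i))) ((cE + 1) * ε) (ext i Vk) := by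
    intro p hp
    rw [hext]
    have h := (dist1_plaqHol_extend_shellGauge_le hd3 (hlohi i) (hn i) hN3 (hbox i) (hZ i) hε hreg).1 p hp
    calc dist1 (plaqHol (extend (pts (k i) (Λ i)) (shellGauge Vk (lo i) (hi i)) Vk) p)
        ≤ 12 * (F.P Kt).d * (n i + 2) ^ 2 * ε := h
      _ ≤ cE * ε := mul_le_mul_of_nonneg_right (hcE i) hε.le
      _ < (cE + 1) * ε := by nlinarith
  -- (b) print's (7) for the datum ALONG THE INDEX `s.Ω`
  have h0 : Node00.Sect2.printedPlaqsTop s.Ω (Node00.suppDomOfRecord F ν Kt s.Ω) (k i) ⊆ plaqsInside (Z i) := by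
    rw [printedPlaqsTop_congr hki hsΩ, Node00.suppDomOfRecord_congr (F := F) ν Kt hw1]
    exact printedPlaqsTop_maxDomT_subset_plaqsInside hM (hdiv i) hki (k i)
  have hsucc : ∀ m, m + 1 ≤ k i → Node00.Sect2.printedPlaqs s.Ω (k i) (m + 1) ⊆ plaqsInside (pts (m + 1) (Z i)) := by
    intro m hm
    refine (Node00.Sect2.printedPlaqs_subset_plaqsOf _ _ _).trans ?_
    refine (plaqsOf_mono (genSet_subset_pts_of_one_le s.Ω (k i) (Nat.succ_pos m))).trans ?_
    rw [hsΩ (m + 1) (Nat.succ_pos m) hm]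
    exact plaqsOf_pts_maxDomT_subset_plaqsInside hM2 (hdiv i) (Nat.succ_pos m) hm
  have h7 : Node00.Sect2.DataSmall7PTop (Node00.avOfRecord F 2 Kt) s.Ω (Node00.suppDomOfRecord F ν Kt s.Ω) (k i)
      (fun _ => (cE + 1) * ε) (avgFamily (Node00.avOfRecord F 2 Kt) (qsstarGIter0 (k i) (ext i Vk))) :=
    dataSmall7PTop_avgFamily_qsstarGIter0 hd ExpMeanLog.expMeanLogSU T3DescentFibreTower.expMeanLogSU_E_one rfl (hk i)
      s.Ω _ (Z i) (hZblk i) h0 hsucc (fun _ _ => hδ₀) (ext i Vk) (fun _ _ => hV)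
  -- (b′) the datum is also REGULAR-REALISED along the index `s.Ω` (`B11Thm1ExistsUniqueRealisedDataQsstar`): ranges at `Z`'s maximal sequence, read back at `s.Ω`
  have h0R : plaqsOf (Node00.suppDomOfRecord F ν Kt s.Ω) ⊆ plaqsInside (Z i) := by
    rw [Node00.suppDomOfRecord_congr (F := F) ν Kt hw1]
    exact plaqsOf_hullD_maxDomT_one_subset_plaqsInside hM (hdiv i) hki
  have h1R : plaqsOf (s.Ω 1) ⊆ plaqsInside (Z i) := by
    rw [hw1]
    exact plaqsOf_maxDomT_one_subset_plaqsInside hM (hdiv i) hki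
  have hfullR : ∀ m, 1 ≤ m → m ≤ k i → plaqsOf (pts m (s.Ω m)) ⊆ plaqsInside (pts m (Z i)) := by
    intro m hm1 hm
    rw [hsΩ m hm1 hm]
    exact plaqsOf_pts_maxDomT_subset_plaqsInside hM2 (hdiv i) hm1 hm
  have h7R : B11Thm1ExistsUniqueRealisedDataB.DataRegularRealisedTop (Node00.avOfRecord F 2 Kt) s.Ω (Node00.suppDomOfRecord F ν Kt s.Ω) (k i)
      (fun _ => (cE + 1) * ε) (avgFamily (Node00.avOfRecord F 2 Kt) (qsstarGIter0 (k i) (ext i Vk))) :=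
    dataRegularRealisedTop_avgFamily_qsstarGIter0 hd ExpMeanLog.expMeanLogSU T3DescentFibreTower.expMeanLogSU_E_one rfl (hk i)
      s.Ω _ (Z i) (hZblk i) h0R h1R hfullR hδ₀ hδ₀ (fun _ _ _ => hδ₀) (ext i Vk) hV hV (fun _ _ _ => hV)
  -- numerics of the thresholds at `ε₀`
  have hnum : ∀ j, j ≤ k i → 0 < (cE + 1) * ε ∧ (cE + 1) * ε ≤ a₁ ∧ B₃ * ((cE + 1) * ε) ≤ ε₀ := fun j _ =>
    ⟨hδ₀, hεa₁, hεr.trans hr₀.le⟩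
  -- the two [15] letters AT THIS INSTANCE's LENGTH at the index `s'`, read back at `s.Ω`, applied to the (1.74) datum
  have h8 := h15T i s' hsep' hM
  have hEU := h15EUT i s' hsep' hM
  rw [hΩ'] at h8 hEU
  have h8W := h8 ε₀ (fun _ => (cE + 1) * ε) hnum (fun _ _ => by linarith) (fun _ _ => by linarith) ha₀ _ h7
  obtain ⟨⟨Ustar, hUstar⟩, huniq⟩ := hEU ε₀ (fun _ => (cE + 1) * ε) hnum (fun _ _ => by linarith) (fun _ _ => by linarith) ha₀ _ h7R
  clear h8 hEU
  -- (c) the (1.74) class and determining set at `maxDomT ν.M₁ Z` ARE those at the index `s`; the class literal at `ε₀` IS the class of record at `ν⟨εreg := ε₀⟩`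
  rw [setOf_class_eq_regMSCoPOfRecord] at hUstar huniq h8W
  have hreg : ∀ e : ℝ, Node00.regMSCoPOfRecord F 2 {ν with εreg := e} Kt (k i) (maxDomT ν.M₁ (Z i)) =
      Node00.regMSCoPOfRecord F 2 {ν with εreg := e} Kt (k i) s.Ω := fun e => (regMSCoPOfRecord_congr F 2 _ Kt hki hsΩ).symm
  have hB : bd (k i) (maxDomT ν.M₁ (Z i)) = bd (k i) s.Ω := (hbdΩ i _ _ hsΩ).symm
  -- the `ε₀`-minimiser `U*` is `B₃(cE+1)ε`-regular, hence in the class at `εr`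
  have h8U := h8W Ustar hUstar
  have hUr : Ustar ∈ Node00.regMSCoPOfRecord F 2 {ν with εreg := εr} Kt (k i) s.Ω := by
    refine ⟨fun j hj p hp => ((h8U.1 j hj) p hp).trans_le ?_, fun j hj b hb => ((h8U.2 j hj) b hb).trans_le ?_⟩
    · exact mul_le_mul_of_nonneg_right hεr (pow_nonneg (eta_pos Kt j).le 2)
    · exact mul_le_mul_of_nonneg_right hεr (pow_nonneg (eta_pos Kt j).le 3)
  have hsub : Node00.regMSCoPOfRecord F 2 {ν with εreg := εr} Kt (k i) s.Ω ⊆ Node00.regMSCoPOfRecord F 2 {ν with εreg := ε₀} Kt (k i) s.Ω :=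
    regMSCoPOfRecord_mono_eps ν Kt (k i) s.Ω hr₀.le
  have hcl : closure (Node00.regMSCoPOfRecord F 2 {ν with εreg := εr} Kt (k i) s.Ω) ⊆ Node00.regMSCoPOfRecord F 2 {ν with εreg := ε₀} Kt (k i) s.Ω :=
    closure_regMSCoPOfRecord_subset_of_lt ν Kt (k i) s.Ω hr₀
  refine ⟨⟨Ustar, ?_⟩, ?_⟩
  · -- (E) at `εr`
    rw [hreg εr, hB]
    exact Node00.IsMinimizerB.of_subset_of_mem hsub hUr hUstar
  · -- (T1@q₀) at `εr`, for every minimiser `U₀`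
    intro U₀ hU₀ U hU hUW hle
    rw [hreg εr, hB] at hU₀
    rw [hreg εr] at hU
    rw [hB] at hUW ⊢
    exact thm1RowB_of_existsUnique (Node00.avOfRecord F 2 Kt)
      (fun U₁ U₂ => ∃ u : GaugeTransf (F.P Kt) 0 SU2,
        (∀ j, j ≤ k i → ∀ b ∈ bd (k i) s.Ω j, toMS u j b.src = toMS u j b.tgt ∧ ∀ g : SU2, toMS u j b.src * g = g * toMS u j b.src) ∧
          gaugeAct u U₁ = U₂)
      hsub hcl ⟨Ustar, hUstar, hUr⟩ huniq hU₀ U hU hUW hle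

end AtZ

end Literature.MathematicalPhysics.QuantumFieldTheory.Balaban1983to89.B15Prop1Thm1RowsOfExistsUniqueAtLengthBR

end
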